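import Literature.NumberTheory.NumberFields.HeckeCharacterRayKernelAvatar
import Literature.NumberTheory.EllipticCurves.DeShalit1987.LMeasureAvatarRigidity
import Literature.NumberTheory.GaloisRepresentations.HeckeCharacterOfGrossencharakter
import Literature.NumberTheory.GaloisRepresentations.HeckeCharacterOfRayClassModulus
import Literature.NumberTheory.GaloisRepresentations.FramedRepBaseChange
import Literature.NumberTheory.EllipticCurves.NewformPadicIntegralModel
import Literature.NumberTheory.Automorphic.AdicCompletionCompact
import HarnessLib

/-!
# Route `SignedLowerHalves`, crux L `SmallImageLowerHalfBothSigns` (item stmt-BirchSwinnertonDyer-23599), line `rtt_w3` v15.1 —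
# INPUT brick hCFT / bk4 of stub A (`stub_charRoadFrame_ns`): CM RECIPROCITY FOR THE PINNED CHARACTER `θ = ψ_𝔭` ON THE RAY CLASS TOWER
# `Gal(K̄/K(𝔐))`, `𝔐 ∣ 𝔪·p^{n+1}`: `‖θ(σ)₀₀ − 1‖ ≤ ‖p‖^{n+1}` and `‖θ'(σ) − 1‖ ≤ ‖p‖^{n+1}`

Resident INPUTS prover `bsd-inputs-honda-p1` g24 (hand on LEAD `cruxlead-stmt-BirchSwinnertonDyer-23599` g11's stub A, inputs hCFT and bk4);
helper `--supports stmt-BirchSwinnertonDyer-23599`; THEOREMS ONLY, no `sorry`; closes nothing; BSD / crux L / stub A are NOT proved by this file.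

WHAT. The stub's character `θ : Γ_K → GL₁(𝒪_{ℚ_p(S)})` is pinned to the Grössencharakter `ψ mod 𝔪` of type `(a, b)` only AWAY from
`p·𝔪` (`θ.HasFrobCharpolyAt w (X − C (e⁻¹(ψ w)))`, `θ` unramified at `w ∤ p𝔪` — hypothesis `hθ` of `stub_charRoadFrame_ns`). Class field
theory (all PROVED in the tree) pins it EVERYWHERE: `θ ⊗ ℚ̄_p` is an avatar of the Hecke character `ω` of `ψ⁻¹` outside the primes of `𝔪`
(`IsPAdicAvatarOutside`), hence Weil's avatar (`IsPAdicAvatarOutside.isPAdicAvatarOf`, Chebotarev rigidity), hence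
`det θ(σ) = ψ_p(x)⁻¹` for `σ|_{K^ab} = [x, K]` (`IsPAdicAvatarOf.det_eq_lAdicAvatarHom_inv`, Weil–Serre), and for
`σ ∈ Gal(K̄/K(𝔐))` one may take `x ∈ W_𝔐` with `x_∞ = 1` (`exists_mem_rayUnitIdeles_infPart_eq_one_of_mem_ker`, Shimura's step);
there `ω(x) = 1` (`𝔐 ∣ 𝔪`, Neukirch VII (6.14)) and `ψ_p(x) = Λ(x) = ∏_{(w,ẽ) : w ∣ p} ẽ(x_w)^{∓n}` with `x_w ≡ 1 (mod p^{n+1})`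
(`𝔐 ∣ p^{n+1}`), so `‖ψ_p(x) − 1‖ ≤ ‖p‖^{n+1}`. Contents:
* §1 `norm_map_le_one_of_mem_adicCompletionIntegers` — a continuous `ẽ : K_w → ℚ̄_p` maps `𝓞_w` into the closed unit ball (compactness of `𝓞_w`);
  `norm_map_sub_one_le_of_mem_rayUnitIdeles` — `‖ẽ(x_w) − 1‖ ≤ ‖p‖^{n+1}` for `x ∈ W_𝔐`, `𝔐 ⊆ (p^{n+1})`, `w ∣ p`.
* §2 `algPart_mem_lOneUnits` — `Λ(x) ∈ U_n = {‖u − 1‖ ≤ ‖p‖^{n+1}}` for such `x`; `heckeOfGross_eq_one_of_mem_rayUnitIdeles` — `ω(x) = 1`.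
* §3 ★ `det_baseChange_mem_lOneUnits` / ★★ `norm_apply_sub_one_le_of_mem_fixingSubgroup` — for `σ ∈ Gal(K̄/K(𝔐))`, `𝔐 ≠ 0`, `𝔐 ⊆ 𝔪`,
  `𝔐 ⊆ (p^{n+1})`: `‖θ(σ)₀₀ − 1‖ ≤ ‖p‖^{n+1}` (in `𝒪` and in `ℚ̄_p`); ★★ `norm_inv_sub_one_le_of_mem_fixingSubgroup` — the same for the
  dual character `θ'` (`θ'·θ₀₀ = 1`, the frame's `θ'`); and the LEAD's shapes at `𝔐 = 𝔪·(p)`: `‖θ'(σ) − 1‖ < 1` on `Gal(K̄/K(𝔪p))` (hCFT),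
  whence bk4 (`χ₀ = 1` there by clause 6 of `exists_teichmullerCharacter`).

References: [SerreAbelianLadic1968] Ch. II §2.7, Ch. III §2.3; [Weil1956] §1–§2; [NeukirchANT1999] Ch. VI §1 (1.7), §6 (6.1), Ch. VII §6 (6.14);
[deShalit1987] II.1.4–1.7 (p. 35–41), II.4.13 (p. 69); [Shimura1998] §18.6.
-/

set_option autoImplicit false
-- D-0017: single-problem summit, the namespace repeats the problem name by design.
set_option linter.dupNamespace false
noncomputable section

open scoped NumberField MatrixGroups Topology nonZeroDivisors
open NumberField IsDedekindDomain IsDedekindDomain.HeightOneSpectrum Polynomial Field Filter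
  Literature.NumberTheory.GaloisRepresentations Literature.NumberTheory.LFunctions
  Literature.NumberTheory.EllipticCurves Literature.NumberTheory.NumberFields
  Literature.NumberTheory.GaloisRepresentations.HeckeCharacter Literature.NumberTheory.GaloisRepresentations.PadicEmbedding

namespace Summit.BirchSwinnertonDyer.BirchSwinnertonDyer.Theorems.SmallImageRttD2FrameReciprocity

variable {K : Type} [Field K] [NumberField K] {p : ℕ} [Fact p.Prime]

/-! ## §1 Continuous local embeddings above `p`: integers go to the unit ball, `W_𝔐`-components to one-units -/

/-- A continuous ring map `ẽ : K_w → ℚ̄_p` sends the (compact) valuation ring `𝓞_w` into the closed unit ball: the powers of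
`ẽ(y)`, `y ∈ 𝓞_w`, stay in the bounded set `ẽ(𝓞_w)`. [cite: SerreAbelianLadic1968, Ch. II §2.7] -/
theorem norm_map_le_one_of_mem_adicCompletionIntegers {w : HeightOneSpectrum (𝓞 K)}
    (E : w.adicCompletion K →+* PadicAlgCl p) (hE : Continuous E) (y : w.adicCompletionIntegers K) :
    ‖E (y : w.adicCompletion K)‖ ≤ 1 := by
  haveI : CompactSpace (w.adicCompletionIntegers K) :=
    Literature.NumberTheory.Automorphic.compactSpace_adicCompletionIntegers' K w
  have hcpt : IsCompact (Set.range fun z : w.adicCompletionIntegers K => E (z : w.adicCompletion K)) :=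
    isCompact_range (hE.comp continuous_subtype_val)
  obtain ⟨C, hC⟩ := hcpt.isBounded.exists_norm_le
  by_contra h
  rw [not_le] at h
  obtain ⟨n, hn⟩ := (tendsto_pow_atTop_atTop_of_one_lt h).eventually_gt_atTop C |>.exists
  have hmem : E ((y ^ n : w.adicCompletionIntegers K) : w.adicCompletion K) ∈
      Set.range fun z : w.adicCompletionIntegers K => E (z : w.adicCompletion K) := ⟨y ^ n, rfl⟩
  have hle := hC _ hmem
  rw [SubmonoidClass.coe_pow, map_pow, norm_pow] at hle
  exact absurd (hn.trans_le hle) (lt_irrefl _)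

/-- For `x ∈ W_𝔐` with `𝔐 ⊆ (p^{n+1})` and a continuous `ẽ : K_w → ℚ̄_p` at a place `w ∣ p`: **`‖ẽ(x_w) − 1‖ ≤ ‖p‖^{n+1}`**
(`x_w − 1 = p^{n+1}·z` with `z ∈ 𝓞_w`). [cite: NeukirchANT1999, Ch. VI §1 Def. (1.7)] [cite: SerreAbelianLadic1968, Ch. II §2.7] -/
theorem norm_map_sub_one_le_of_mem_rayUnitIdeles {𝔐 : Ideal (𝓞 K)} (h𝔐 : 𝔐 ≠ ⊥) {n : ℕ}
    (h𝔐p : 𝔐 ≤ Ideal.span {((p : ℕ) : 𝓞 K) ^ (n + 1)}) {x : ideleGroup K} (hx : x ∈ rayUnitIdeles K 𝔐)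
    {w : HeightOneSpectrum (𝓞 K)} (E : w.adicCompletion K →+* PadicAlgCl p) (hE : Continuous E) :
    ‖E ((x : AdeleRing (𝓞 K) K).2 w) - 1‖ ≤ ‖(p : PadicAlgCl p)‖ ^ (n + 1) := by
  -- the valuation of `p^{n+1}` at `w` dominates that of `x_w - 1`
  set q : w.adicCompletion K := algebraMap K (w.adicCompletion K) (((p : ℕ) : K) ^ (n + 1)) with hq_def
  have hpn0 : (((p : ℕ) : 𝓞 K) ^ (n + 1)) ≠ 0 := pow_ne_zero _ (by exact_mod_cast (Fact.out : p.Prime).ne_zero)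
  have hspan0 : (Ideal.span {((p : ℕ) : 𝓞 K) ^ (n + 1)} : Ideal (𝓞 K)) ≠ ⊥ := by
    rw [Ne, Ideal.span_singleton_eq_bot]; exact hpn0
  have hvq : Valued.v q = WithZero.exp (-(FractionalIdeal.count K w
      ((Ideal.span {((p : ℕ) : 𝓞 K) ^ (n + 1)} : Ideal (𝓞 K)) : FractionalIdeal (𝓞 K)⁰ K))) := by
    rw [hq_def, show (((p : ℕ) : K) ^ (n + 1)) = algebraMap (𝓞 K) K (((p : ℕ) : 𝓞 K) ^ (n + 1)) by simp,
      show Valued.v (algebraMap K (w.adicCompletion K) (algebraMap (𝓞 K) K (((p : ℕ) : 𝓞 K) ^ (n + 1)))) =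
          w.valuation K (algebraMap (𝓞 K) K (((p : ℕ) : 𝓞 K) ^ (n + 1))) from valuedAdicCompletion_eq_valuation' w _,
      valuation_of_algebraMap, intValuation_if_neg _ hpn0,
      FractionalIdeal.count_coe K w (show (Ideal.span {((p : ℕ) : 𝓞 K) ^ (n + 1)} : Ideal (𝓞 K)) ≠ 0 from hspan0)]
  have hcount : FractionalIdeal.count K w ((Ideal.span {((p : ℕ) : 𝓞 K) ^ (n + 1)} : Ideal (𝓞 K)) : FractionalIdeal (𝓞 K)⁰ K) ≤
      FractionalIdeal.count K w ((𝔐 : Ideal (𝓞 K)) : FractionalIdeal (𝓞 K)⁰ K) :=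
    FractionalIdeal.count_mono K w (FractionalIdeal.coeIdeal_ne_zero.2 h𝔐) ((FractionalIdeal.coeIdeal_le_coeIdeal K).2 h𝔐p)
  have hx1 : Valued.v ((x : AdeleRing (𝓞 K) K).2 w - 1) ≤ Valued.v q := by
    refine ((mem_rayUnitIdeles_iff x).mp hx w).2.trans ?_
    rw [hvq, WithZero.exp_le_exp, neg_le_neg_iff]
    exact hcount
  have hq0 : q ≠ 0 := by
    rw [hq_def, map_ne_zero_iff _ (algebraMap K (w.adicCompletion K)).injective]
    exact pow_ne_zero _ (by exact_mod_cast (Fact.out : p.Prime).ne_zero)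
  -- `z := (x_w - 1) / p^{n+1} ∈ 𝓞_w`
  have hz : ((x : AdeleRing (𝓞 K) K).2 w - 1) * q⁻¹ ∈ w.adicCompletionIntegers K := by
    rw [mem_adicCompletionIntegers, map_mul, map_inv₀]
    calc Valued.v ((x : AdeleRing (𝓞 K) K).2 w - 1) * (Valued.v q)⁻¹
        ≤ Valued.v q * (Valued.v q)⁻¹ := mul_le_mul_left hx1 _
      _ = 1 := mul_inv_cancel₀ ((Valuation.ne_zero_iff _).mpr hq0)
  have hEq : E q = (p : PadicAlgCl p) ^ (n + 1) := by
    rw [hq_def, map_pow, map_natCast, map_pow, map_natCast]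
  have hdecomp : E ((x : AdeleRing (𝓞 K) K).2 w) - 1 =
      (p : PadicAlgCl p) ^ (n + 1) * E (((x : AdeleRing (𝓞 K) K).2 w - 1) * q⁻¹) := by
    rw [← hEq, ← map_mul, mul_comm q, inv_mul_cancel_right₀ hq0, map_sub, map_one]
  rw [hdecomp, norm_mul, norm_pow]
  exact mul_le_of_le_one_right (pow_nonneg (norm_nonneg _) _)
    (norm_map_le_one_of_mem_adicCompletionIntegers E hE ⟨_, hz⟩)

/-! ## §2 On a kernel idele `x ∈ W_𝔐`: `Λ(x)` is a one-unit of level `n`, and `ω(x) = 1` -/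

/-- **`Λ(x) ∈ U_n`**: for `x ∈ W_𝔐`, `𝔐 ⊆ (p^{n+1})`, the algebraic part `Λ(x) = ∏_{(w,ẽ) : w ∣ p} ẽ(x_w)^{−n_{(w,ẽ)}}` of Weil's `p`-adic
avatar is a one-unit of level `n` (`‖Λ(x) − 1‖ ≤ ‖p‖^{n+1}`; `U_n = lOneUnits p n` is a subgroup). [cite: SerreAbelianLadic1968, Ch. II §2.7] -/
theorem algPart_mem_lOneUnits {𝔐 : Ideal (𝓞 K)} (h𝔐 : 𝔐 ≠ ⊥) {n : ℕ} (h𝔐p : 𝔐 ≤ Ideal.span {((p : ℕ) : 𝓞 K) ^ (n + 1)})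
    {x : ideleGroup K} (hx : x ∈ rayUnitIdeles K 𝔐) (e : PadicAlgCl p ≃+* ℂ) (pp qq : InfinitePlace K → ℤ) :
    algPart e pp qq x ∈ lOneUnits p n := by
  rw [algPart_apply]
  refine Subgroup.prod_mem _ fun E _ => Subgroup.zpow_mem _ ?_ _
  rw [mem_lOneUnits_iff, PlaceEmb.coe_eval]
  exact norm_map_sub_one_le_of_mem_rayUnitIdeles h𝔐 h𝔐p hx E.2.1 E.2.2

/-- **`ω(x) = 1`** for the Hecke character `ω` of a Grössencharakter `mod 𝔪` and `x ∈ W_𝔐`, `𝔐 ⊆ 𝔪`, `x_∞ = 1`: `x` is a unit idele in the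
congruence subgroup `mod 𝔪`, where `ω = ω₀ = χ̃((x)^𝔪)·A(x_∞) = 1`. [cite: NeukirchANT1999, Ch. VII §6 Cor. (6.14)] -/
theorem heckeOfGross_eq_one_of_mem_rayUnitIdeles {𝔪 : Ideal (𝓞 K)} (h𝔪 : 𝔪 ≠ ⊥) {a b : InfinitePlace K → ℤ}
    {ψ : HeightOneSpectrum (𝓞 K) → ℂ} (hψ : IsGrossencharakter 𝔪 a b ψ) {𝔐 : Ideal (𝓞 K)} (h𝔐 : 𝔐 ≠ ⊥) (h𝔐𝔪 : 𝔐 ≤ 𝔪)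
    {x : ideleGroup K} (hx : x ∈ rayUnitIdeles K 𝔐) (hinf : infPart K x = 1) :
    heckeOfGross h𝔪 hψ x = 1 := by
  -- `x ∈ W_𝔪 ⊆ I_f^𝔪`
  have hx𝔪 : x ∈ rayUnitIdeles K 𝔪 := by
    rw [mem_rayUnitIdeles_iff] at hx ⊢
    intro v
    refine ⟨(hx v).1, (hx v).2.trans ?_⟩
    rw [WithZero.exp_le_exp, neg_le_neg_iff]
    exact FractionalIdeal.count_mono K v (FractionalIdeal.coeIdeal_ne_zero.2 h𝔐) ((FractionalIdeal.coeIdeal_le_coeIdeal K).2 h𝔐𝔪)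
  have h1 : (x : AdeleRing (𝓞 K) K).1 = 1 := by rw [← val_infPart, hinf, Units.val_one]
  have hcong : x ∈ congruenceIdeles 𝔪 := by
    refine mem_congruenceIdeles_of_fst_eq_one h𝔪 (T := (Ideal.finite_factors h𝔪).toFinset) (e := modulusExp 𝔪)
      (fun v hv => ⟨(Ideal.finite_factors h𝔪).mem_toFinset.mpr (Ideal.dvd_iff_le.mpr hv), le_rfl⟩) h1 fun v _ => ?_
    have h := ((mem_rayUnitIdeles_iff x).mp hx𝔪 v).2
    rwa [FractionalIdeal.count_coe K v (show 𝔪 ≠ 0 from h𝔪)] at h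
  have hu : x ∈ unitIdeles K := rayUnitIdeles_le_unitIdeles hx
  rw [heckeOfGross_apply, heckeOfGrossFun_eq_archIdeleChar_of_mem h𝔪 hψ hcong hu]
  ext
  rw [coe_archIdeleChar_apply, hinf, map_one, Units.val_one]

/-- The norm of `𝒪 = 𝒪_{ℚ_p(S)} ⊆ ℚ̄_p` is the restriction of that of `ℚ̄_p`. [folklore] -/
theorem norm_coeffIntegers_eq (S : Set (PadicAlgCl p)) (x : padicCoeffIntegers S) : ‖x‖ = ‖(x : PadicAlgCl p)‖ := rfl

/-- `‖(p : 𝒪)‖ = ‖(p : ℚ̄_p)‖`. [folklore] -/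
theorem norm_natCast_coeffIntegers (S : Set (PadicAlgCl p)) : ‖(p : padicCoeffIntegers S)‖ = ‖(p : PadicAlgCl p)‖ := by
  rw [norm_coeffIntegers_eq, Subring.coe_natCast]

/-! ## §3 The pinned character on `Gal(K̄/K(𝔐))` -/

/-- ★ **`det (θ ⊗ ℚ̄_p)(σ) ∈ U_n` for `σ ∈ Gal(K̄/K(𝔐))`.** For `K` totally complex, a Grössencharakter `ψ mod 𝔪` of type `(a, b)`, a continuous
`r : Γ_K → GL₁(ℚ̄_p)` pinned to `ψ` away from `p𝔪` (`r` unramified at `w ∤ p𝔪` with arithmetic-Frobenius polynomial `X − e⁻¹(ψ w)`), a modulus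
`𝔐 ≠ 0` with `𝔐 ⊆ 𝔪` and `𝔐 ⊆ (p^{n+1})`, and `σ ∈ Gal(K̄/K(𝔐))`: `‖det r(σ) − 1‖ ≤ ‖p‖^{n+1}`. Proof: `r` is an avatar of the Hecke character
`ω` of `ψ⁻¹` outside the primes of `𝔪`, hence Weil's avatar (Chebotarev); `σ|_{K^ab} = [x, K]` with `x ∈ W_𝔐`, `x_∞ = 1` (Shimura); `det r(σ) =
ψ_p(x)⁻¹ = (ι⁻¹(ω x)·Λ(x))⁻¹ = Λ(x)⁻¹ ∈ U_n` (§2). [cite: SerreAbelianLadic1968, Ch. II §2.7, Ch. III §2.3] [cite: Weil1956, §1–§2]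
[cite: Shimura1998, §18.6] [cite: deShalit1987, II.4.13 (p. 69)] -/
theorem det_mem_lOneUnits_of_mem_fixingSubgroup [IsTotallyComplex K] {𝔪 : Ideal (𝓞 K)} (h𝔪 : 𝔪 ≠ ⊥)
    {a b : InfinitePlace K → ℤ} {ψ : HeightOneSpectrum (𝓞 K) → ℂ} (hψ : IsGrossencharakter 𝔪 a b ψ)
    (e : PadicAlgCl p ≃+* ℂ) (r : FramedGaloisRep K (PadicAlgCl p) 1)
    (hr : ∀ w : HeightOneSpectrum (𝓞 K), ((p : ℕ) : 𝓞 K) ∉ w.asIdeal → ¬ 𝔪 ≤ w.asIdeal →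
      r.IsUnramifiedAt w ∧ r.HasFrobCharpolyAt w (X - C (e.symm (ψ w))))
    {𝔐 : Ideal (𝓞 K)} (h𝔐 : 𝔐 ≠ ⊥) (h𝔐𝔪 : 𝔐 ≤ 𝔪) {n : ℕ} (h𝔐p : 𝔐 ≤ Ideal.span {((p : ℕ) : 𝓞 K) ^ (n + 1)})
    {σ : absoluteGaloisGroup K} (hσ : σ ∈ absGaloisFixingSubgroup (rayClassField K 𝔐)) :
    FramedRep.det r σ ∈ lOneUnits p n := by
  -- `ψ⁻¹` is a Grössencharakter mod `𝔪` of type `(-a, -b)` (as in `…RttCharRoadPinnedCharacter`)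
  have hpow : ∀ I : Ideal (𝓞 K), idealPow K (fun v => (ψ v)⁻¹) I = (idealPow K ψ I)⁻¹ := fun I => by
    rw [idealPow, idealPow, ← finprod_inv_distrib]
    exact finprod_congr fun v => inv_pow _ _
  have hinv : IsGrossencharakter 𝔪 (fun w => -a w) (fun w => -b w) (fun v => (ψ v)⁻¹) := by
    refine ⟨fun v hv => inv_ne_zero (hψ.ne_zero v hv), fun c d hc hd hcop hcd hpos => ?_⟩
    rw [hpow, hpow, hψ.idealPow_span_eq c d hc hd hcop hcd hpos, mul_inv, ← Finset.prod_inv_distrib]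
    refine congrArg _ (Finset.prod_congr rfl fun w _ => ?_)
    rw [mul_inv, zpow_neg, zpow_neg]
  have hinf : (heckeOfGross h𝔪 hinv).HasInfinityType (fun w => -a w) (fun w => -b w) := heckeOfGross_hasInfinityType h𝔪 hinv
  -- `r` is an avatar of `ω` outside the primes of `𝔪`, hence an avatar
  have hout : IsPAdicAvatarOutside (Ideal.finite_factors h𝔪).toFinset e (heckeOfGross h𝔪 hinv) r := fun v hvT hvp _ => by
    have hv : ¬ 𝔪 ≤ v.asIdeal := fun hle => hvT ((Ideal.finite_factors h𝔪).mem_toFinset.mpr (Ideal.dvd_iff_le.mpr hle))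
    refine ⟨(hr v hvp hv).1, ?_⟩
    rw [heckeOfGross_valueAtUniformizer h𝔪 hinv hv, map_inv₀ e.symm (ψ v), inv_inv]
    exact (hr v hvp hv).2
  have hav : IsPAdicAvatarOf e (heckeOfGross h𝔪 hinv) r := hout.isPAdicAvatarOf (heckeOfGross_isAlgebraic h𝔪 hinv)
  -- Shimura's kernel idele
  have hσ' : σ ∈ (absRestrictNormalHom (rayClassField K 𝔐)).ker := hσ
  obtain ⟨x, hx, hxinf, hσx⟩ := exists_mem_rayUnitIdeles_infPart_eq_one_of_mem_ker hσ'
  rw [hav.det_eq_lAdicAvatarHom_inv hinf e hσx]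
  refine Subgroup.inv_mem _ ?_
  have hωx : heckeOfGross h𝔪 hinv x = 1 := heckeOfGross_eq_one_of_mem_rayUnitIdeles h𝔪 hinv h𝔐 h𝔐𝔪 hx hxinf
  have heq : lAdicAvatarHom (heckeOfGross h𝔪 hinv) e (fun w => -a w) (fun w => -b w) x =
      algPart e (fun w => -a w) (fun w => -b w) x := by
    ext
    rw [HeckeCharacter.coe_lAdicAvatarHom_of_infPart_eq_one _ e _ _ hxinf, hωx, Units.val_one, map_one, one_mul]
  rw [heq]
  exact algPart_mem_lOneUnits h𝔐 h𝔐p hx e _ _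

/-- ★★ **CM reciprocity for the stub's pinned character `θ : Γ_K → GL₁(𝒪_{ℚ_p(S)})`** (hypothesis `hθ` of `stub_charRoadFrame_ns` verbatim): for
`σ ∈ Gal(K̄/K(𝔐))`, `𝔐 ≠ 0`, `𝔐 ⊆ 𝔪`, `𝔐 ⊆ (p^{n+1})`: **`‖θ(σ)₀₀ − 1‖ ≤ ‖p‖^{n+1}`** (read in `ℚ̄_p`). [cite: SerreAbelianLadic1968, Ch. II §2.7]
[cite: Weil1956, §1–§2] [cite: NeukirchANT1999, Ch. VI §6 (6.1), Ch. VII §6 (6.14)] -/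
theorem norm_coe_apply_sub_one_le_of_mem_fixingSubgroup [IsTotallyComplex K] {𝔪 : Ideal (𝓞 K)} (h𝔪 : 𝔪 ≠ ⊥)
    {a b : InfinitePlace K → ℤ} {ψ : HeightOneSpectrum (𝓞 K) → ℂ} (hψ : IsGrossencharakter 𝔪 a b ψ)
    (e : PadicAlgCl p ≃+* ℂ) (S : Set (PadicAlgCl p)) (θ : FramedGaloisRep K (padicCoeffIntegers S) 1)
    (hθ : ∀ w : HeightOneSpectrum (𝓞 K), ((p : ℕ) : 𝓞 K) ∉ w.asIdeal → ¬ 𝔪 ≤ w.asIdeal →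
      θ.IsUnramifiedAt w ∧ ∃ P : Polynomial (padicCoeffIntegers S),
        P.map (padicCoeffIntegers S).subtype = X - C (e.symm (ψ w)) ∧ θ.HasFrobCharpolyAt w P)
    {𝔐 : Ideal (𝓞 K)} (h𝔐 : 𝔐 ≠ ⊥) (h𝔐𝔪 : 𝔐 ≤ 𝔪) {n : ℕ} (h𝔐p : 𝔐 ≤ Ideal.span {((p : ℕ) : 𝓞 K) ^ (n + 1)})
    {σ : absoluteGaloisGroup K} (hσ : σ ∈ absGaloisFixingSubgroup (rayClassField K 𝔐)) :
    ‖((((θ σ : GL (Fin 1) (padicCoeffIntegers S)) : Matrix (Fin 1) (Fin 1) (padicCoeffIntegers S)) 0 0 :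
        padicCoeffIntegers S) : PadicAlgCl p) - 1‖ ≤ ‖(p : PadicAlgCl p)‖ ^ (n + 1) := by
  set r : FramedGaloisRep K (PadicAlgCl p) 1 := FramedRep.baseChange (padicCoeffIntegers S).subtype continuous_subtype_val θ
    with hr_def
  have hr : ∀ w : HeightOneSpectrum (𝓞 K), ((p : ℕ) : 𝓞 K) ∉ w.asIdeal → ¬ 𝔪 ≤ w.asIdeal →
      r.IsUnramifiedAt w ∧ r.HasFrobCharpolyAt w (X - C (e.symm (ψ w))) := fun w hwp hw => by
    obtain ⟨hunr, P, hP, hfrob⟩ := hθ w hwp hw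
    refine ⟨(FramedGaloisRep.isUnramifiedAt_baseChange_iff _ continuous_subtype_val Subtype.val_injective w θ).mpr hunr, ?_⟩
    rw [← hP]
    exact (FramedGaloisRep.hasFrobCharpolyAt_baseChange_iff _ continuous_subtype_val Subtype.val_injective w θ P).mpr hfrob
  have hmem := det_mem_lOneUnits_of_mem_fixingSubgroup h𝔪 hψ e r hr h𝔐 h𝔐𝔪 h𝔐p hσ
  rw [mem_lOneUnits_iff, FramedGaloisRep.coe_det_apply_of_rank_one, hr_def, FramedRep.coe_baseChange_apply,
    Matrix.map_apply] at hmem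
  exact hmem

/-- ★★ The same **in the coefficient ring `𝒪 = 𝒪_{ℚ_p(S)}`**: `‖θ(σ)₀₀ − 1‖ ≤ ‖p‖^{n+1}` for `σ ∈ Gal(K̄/K(𝔐))`. [cite: SerreAbelianLadic1968, Ch. II §2.7]
[cite: Weil1956, §1–§2] [cite: NeukirchANT1999, Ch. VII §6 (6.14)] -/
theorem norm_apply_sub_one_le_of_mem_fixingSubgroup [IsTotallyComplex K] {𝔪 : Ideal (𝓞 K)} (h𝔪 : 𝔪 ≠ ⊥)
    {a b : InfinitePlace K → ℤ} {ψ : HeightOneSpectrum (𝓞 K) → ℂ} (hψ : IsGrossencharakter 𝔪 a b ψ)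
    (e : PadicAlgCl p ≃+* ℂ) (S : Set (PadicAlgCl p)) (θ : FramedGaloisRep K (padicCoeffIntegers S) 1)
    (hθ : ∀ w : HeightOneSpectrum (𝓞 K), ((p : ℕ) : 𝓞 K) ∉ w.asIdeal → ¬ 𝔪 ≤ w.asIdeal →
      θ.IsUnramifiedAt w ∧ ∃ P : Polynomial (padicCoeffIntegers S),
        P.map (padicCoeffIntegers S).subtype = X - C (e.symm (ψ w)) ∧ θ.HasFrobCharpolyAt w P)
    {𝔐 : Ideal (𝓞 K)} (h𝔐 : 𝔐 ≠ ⊥) (h𝔐𝔪 : 𝔐 ≤ 𝔪) {n : ℕ} (h𝔐p : 𝔐 ≤ Ideal.span {((p : ℕ) : 𝓞 K) ^ (n + 1)})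
    {σ : absoluteGaloisGroup K} (hσ : σ ∈ absGaloisFixingSubgroup (rayClassField K 𝔐)) :
    ‖((θ σ : GL (Fin 1) (padicCoeffIntegers S)) : Matrix (Fin 1) (Fin 1) (padicCoeffIntegers S)) 0 0 - 1‖ ≤
      ‖(p : padicCoeffIntegers S)‖ ^ (n + 1) := by
  have h := norm_coe_apply_sub_one_le_of_mem_fixingSubgroup h𝔪 hψ e S θ hθ h𝔐 h𝔐𝔪 h𝔐p hσ
  rw [norm_coeffIntegers_eq, norm_natCast_coeffIntegers, AddSubgroupClass.coe_sub, OneMemClass.coe_one]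
  exact h

/-- ★★ **The dual character `θ'` (`θ'·θ₀₀ = 1`, the frame's `θ' = θ*`) on `Gal(K̄/K(𝔐))`: `‖θ'(σ) − 1‖ ≤ ‖p‖^{n+1}`**
(`θ'(σ) − 1 = θ'(σ)·(1 − θ(σ)₀₀)` and `‖θ'(σ)‖ ≤ 1`). [cite: SerreAbelianLadic1968, Ch. II §2.7] [cite: Weil1956, §1–§2]
[cite: NeukirchANT1999, Ch. VII §6 (6.14)] -/
theorem norm_dual_sub_one_le_of_mem_fixingSubgroup [IsTotallyComplex K] {𝔪 : Ideal (𝓞 K)} (h𝔪 : 𝔪 ≠ ⊥)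
    {a b : InfinitePlace K → ℤ} {ψ : HeightOneSpectrum (𝓞 K) → ℂ} (hψ : IsGrossencharakter 𝔪 a b ψ)
    (e : PadicAlgCl p ≃+* ℂ) (S : Set (PadicAlgCl p)) (θ : FramedGaloisRep K (padicCoeffIntegers S) 1)
    (hθ : ∀ w : HeightOneSpectrum (𝓞 K), ((p : ℕ) : 𝓞 K) ∉ w.asIdeal → ¬ 𝔪 ≤ w.asIdeal →
      θ.IsUnramifiedAt w ∧ ∃ P : Polynomial (padicCoeffIntegers S),
        P.map (padicCoeffIntegers S).subtype = X - C (e.symm (ψ w)) ∧ θ.HasFrobCharpolyAt w P)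
    (θ' : absoluteGaloisGroup K →ₜ* (padicCoeffIntegers S)ˣ)
    (hθ' : ∀ g : absoluteGaloisGroup K, ((θ' g : (padicCoeffIntegers S)ˣ) : padicCoeffIntegers S) *
      ((θ g : GL (Fin 1) (padicCoeffIntegers S)) : Matrix (Fin 1) (Fin 1) (padicCoeffIntegers S)) 0 0 = 1)
    {𝔐 : Ideal (𝓞 K)} (h𝔐 : 𝔐 ≠ ⊥) (h𝔐𝔪 : 𝔐 ≤ 𝔪) {n : ℕ} (h𝔐p : 𝔐 ≤ Ideal.span {((p : ℕ) : 𝓞 K) ^ (n + 1)})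
    {σ : absoluteGaloisGroup K} (hσ : σ ∈ absGaloisFixingSubgroup (rayClassField K 𝔐)) :
    ‖((θ' σ : (padicCoeffIntegers S)ˣ) : padicCoeffIntegers S) - 1‖ ≤ ‖(p : padicCoeffIntegers S)‖ ^ (n + 1) := by
  have h := norm_apply_sub_one_le_of_mem_fixingSubgroup h𝔪 hψ e S θ hθ h𝔐 h𝔐𝔪 h𝔐p hσ
  set t : padicCoeffIntegers S := ((θ' σ : (padicCoeffIntegers S)ˣ) : padicCoeffIntegers S) with ht
  set u : padicCoeffIntegers S := ((θ σ : GL (Fin 1) (padicCoeffIntegers S)) : Matrix (Fin 1) (Fin 1) (padicCoeffIntegers S)) 0 0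
    with hu
  have htu : t * u = 1 := hθ' σ
  have hdec : t - 1 = t * (1 - u) := by rw [mul_sub, mul_one, htu]
  have ht1 : ‖t‖ ≤ 1 := t.2.2
  rw [hdec, norm_mul, norm_sub_rev]
  calc ‖t‖ * ‖u - 1‖ ≤ 1 * ‖(p : padicCoeffIntegers S)‖ ^ (n + 1) := mul_le_mul ht1 h (norm_nonneg _) zero_le_one
    _ = ‖(p : padicCoeffIntegers S)‖ ^ (n + 1) := one_mul _

/-! ## §4 The LEAD's shapes at `𝔐 = 𝔪·(p)` (hCFT, bk4) -/

/-- `𝔪·(p) ≠ 0`, `𝔪·(p) ⊆ 𝔪`, `𝔪·(p) ⊆ (p^{0+1})`. [folklore] -/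
theorem mul_span_natCast_props {𝔪 : Ideal (𝓞 K)} (h𝔪 : 𝔪 ≠ ⊥) :
    𝔪 * Ideal.span {((p : ℕ) : 𝓞 K)} ≠ ⊥ ∧ 𝔪 * Ideal.span {((p : ℕ) : 𝓞 K)} ≤ 𝔪 ∧
      𝔪 * Ideal.span {((p : ℕ) : 𝓞 K)} ≤ Ideal.span {((p : ℕ) : 𝓞 K) ^ (0 + 1)} := by
  refine ⟨?_, Ideal.mul_le_right, ?_⟩
  · have hp : (Ideal.span {((p : ℕ) : 𝓞 K)} : Ideal (𝓞 K)) ≠ ⊥ := by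
      rw [Ne, Ideal.span_singleton_eq_bot]; exact_mod_cast (Fact.out : p.Prime).ne_zero
    exact mul_ne_zero h𝔪 hp
  · rw [zero_add, pow_one]; exact Ideal.mul_le_left

/-- ★★★ **hCFT of stub A** (LEAD `cruxlead-23599` g11, PROGRESS 16): for `σ ∈ Gal(K̄/K(𝔪p))`, **`‖θ'(σ) − 1‖ ≤ ‖p‖ < 1`** for the frame's dual
character `θ'` (`θ'·θ₀₀ = 1`) of the stub's pinned `θ`; whence bk4: the Teichmüller part `χ₀` of `θ'` is trivial on `Gal(K̄/K(𝔪p))` (clause 6 of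
`SmallImageRttD2Twist.exists_teichmullerCharacter`), i.e. `𝔣 := 𝔪·p` is an admissible conductor for `cor53_thm52ShapeO`.
[cite: deShalit1987, II.1.4–1.7 (p. 35–41)] [cite: SerreAbelianLadic1968, Ch. II §2.7] [cite: NeukirchANT1999, Ch. VII §6 (6.14)] -/
theorem norm_dual_sub_one_lt_one_of_mem_fixingSubgroup_mul [IsTotallyComplex K] {𝔪 : Ideal (𝓞 K)} (h𝔪 : 𝔪 ≠ ⊥)
    {a b : InfinitePlace K → ℤ} {ψ : HeightOneSpectrum (𝓞 K) → ℂ} (hψ : IsGrossencharakter 𝔪 a b ψ)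
    (e : PadicAlgCl p ≃+* ℂ) (S : Set (PadicAlgCl p)) (θ : FramedGaloisRep K (padicCoeffIntegers S) 1)
    (hθ : ∀ w : HeightOneSpectrum (𝓞 K), ((p : ℕ) : 𝓞 K) ∉ w.asIdeal → ¬ 𝔪 ≤ w.asIdeal →
      θ.IsUnramifiedAt w ∧ ∃ P : Polynomial (padicCoeffIntegers S),
        P.map (padicCoeffIntegers S).subtype = X - C (e.symm (ψ w)) ∧ θ.HasFrobCharpolyAt w P)
    (θ' : absoluteGaloisGroup K →ₜ* (padicCoeffIntegers S)ˣ)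
    (hθ' : ∀ g : absoluteGaloisGroup K, ((θ' g : (padicCoeffIntegers S)ˣ) : padicCoeffIntegers S) *
      ((θ g : GL (Fin 1) (padicCoeffIntegers S)) : Matrix (Fin 1) (Fin 1) (padicCoeffIntegers S)) 0 0 = 1)
    {σ : absoluteGaloisGroup K} (hσ : σ ∈ absGaloisFixingSubgroup (rayClassField K (𝔪 * Ideal.span {((p : ℕ) : 𝓞 K)}))) :
    ‖((θ' σ : (padicCoeffIntegers S)ˣ) : padicCoeffIntegers S) - 1‖ ≤ ‖(p : padicCoeffIntegers S)‖ ∧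
      ‖((θ' σ : (padicCoeffIntegers S)ˣ) : padicCoeffIntegers S) - 1‖ < 1 := by
  obtain ⟨h1, h2, h3⟩ := mul_span_natCast_props (K := K) (p := p) h𝔪
  have h := norm_dual_sub_one_le_of_mem_fixingSubgroup h𝔪 hψ e S θ hθ θ' hθ' h1 h2 h3 hσ
  rw [zero_add, pow_one] at h
  refine ⟨h, h.trans_lt ?_⟩
  rw [norm_natCast_coeffIntegers]
  exact Literature.NumberTheory.Automorphic.PadicAlgCl.norm_natCast_p_lt_one p

/-- ★★★ The same for `θ` itself: `‖θ(σ)₀₀ − 1‖ ≤ ‖p‖ < 1` on `Gal(K̄/K(𝔪p))`. [cite: deShalit1987, II.1.4–1.7 (p. 35–41)]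
[cite: SerreAbelianLadic1968, Ch. II §2.7] -/
theorem norm_apply_sub_one_lt_one_of_mem_fixingSubgroup_mul [IsTotallyComplex K] {𝔪 : Ideal (𝓞 K)} (h𝔪 : 𝔪 ≠ ⊥)
    {a b : InfinitePlace K → ℤ} {ψ : HeightOneSpectrum (𝓞 K) → ℂ} (hψ : IsGrossencharakter 𝔪 a b ψ)
    (e : PadicAlgCl p ≃+* ℂ) (S : Set (PadicAlgCl p)) (θ : FramedGaloisRep K (padicCoeffIntegers S) 1)
    (hθ : ∀ w : HeightOneSpectrum (𝓞 K), ((p : ℕ) : 𝓞 K) ∉ w.asIdeal → ¬ 𝔪 ≤ w.asIdeal →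
      θ.IsUnramifiedAt w ∧ ∃ P : Polynomial (padicCoeffIntegers S),
        P.map (padicCoeffIntegers S).subtype = X - C (e.symm (ψ w)) ∧ θ.HasFrobCharpolyAt w P)
    {σ : absoluteGaloisGroup K} (hσ : σ ∈ absGaloisFixingSubgroup (rayClassField K (𝔪 * Ideal.span {((p : ℕ) : 𝓞 K)}))) :
    ‖((θ σ : GL (Fin 1) (padicCoeffIntegers S)) : Matrix (Fin 1) (Fin 1) (padicCoeffIntegers S)) 0 0 - 1‖ ≤
        ‖(p : padicCoeffIntegers S)‖ ∧
      ‖((θ σ : GL (Fin 1) (padicCoeffIntegers S)) : Matrix (Fin 1) (Fin 1) (padicCoeffIntegers S)) 0 0 - 1‖ < 1 := by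
  obtain ⟨h1, h2, h3⟩ := mul_span_natCast_props (K := K) (p := p) h𝔪
  have h := norm_apply_sub_one_le_of_mem_fixingSubgroup h𝔪 hψ e S θ hθ h1 h2 h3 hσ
  rw [zero_add, pow_one] at h
  refine ⟨h, h.trans_lt ?_⟩
  rw [norm_natCast_coeffIntegers]
  exact Literature.NumberTheory.Automorphic.PadicAlgCl.norm_natCast_p_lt_one p

/-! ## §5 (appended, g24) The infinite level: `θ` and `θ'` are trivial on `Gal(K̄/K(𝔪p^∞)) = ⋂ₙ Gal(K̄/K(𝔪p^{n+1}))` -/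

/-- `𝔪·(p)^{n+1} ≠ 0`, `⊆ 𝔪`, `⊆ (p^{n+1})`. [folklore] -/
theorem mul_span_natCast_pow_props {𝔪 : Ideal (𝓞 K)} (h𝔪 : 𝔪 ≠ ⊥) (n : ℕ) :
    𝔪 * Ideal.span {((p : ℕ) : 𝓞 K)} ^ (n + 1) ≠ ⊥ ∧ 𝔪 * Ideal.span {((p : ℕ) : 𝓞 K)} ^ (n + 1) ≤ 𝔪 ∧
      𝔪 * Ideal.span {((p : ℕ) : 𝓞 K)} ^ (n + 1) ≤ Ideal.span {((p : ℕ) : 𝓞 K) ^ (n + 1)} := by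
  have hp : (Ideal.span {((p : ℕ) : 𝓞 K)} : Ideal (𝓞 K)) ≠ ⊥ := by
    rw [Ne, Ideal.span_singleton_eq_bot]; exact_mod_cast (Fact.out : p.Prime).ne_zero
  refine ⟨mul_ne_zero h𝔪 (pow_ne_zero _ hp), Ideal.mul_le_right, ?_⟩
  rw [Ideal.span_singleton_pow]
  exact Ideal.mul_le_left

/-- ★★ **`θ(σ)₀₀ = 1` for `σ ∈ Gal(K̄/K(𝔪p^∞))`**, i.e. for `σ` fixing every `K(𝔪p^{n+1})`: the pinned character FACTORS THROUGH
`Gal(K(𝔪p^∞)/K)` (`‖θ(σ)₀₀ − 1‖ ≤ ‖p‖^{n+1}` for all `n`). [cite: deShalit1987, II.1.4–1.7 (p. 35–41), II.4.13 (p. 69)]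
[cite: SerreAbelianLadic1968, Ch. II §2.7] -/
theorem apply_eq_one_of_forall_mem_fixingSubgroup [IsTotallyComplex K] {𝔪 : Ideal (𝓞 K)} (h𝔪 : 𝔪 ≠ ⊥)
    {a b : InfinitePlace K → ℤ} {ψ : HeightOneSpectrum (𝓞 K) → ℂ} (hψ : IsGrossencharakter 𝔪 a b ψ)
    (e : PadicAlgCl p ≃+* ℂ) (S : Set (PadicAlgCl p)) (θ : FramedGaloisRep K (padicCoeffIntegers S) 1)
    (hθ : ∀ w : HeightOneSpectrum (𝓞 K), ((p : ℕ) : 𝓞 K) ∉ w.asIdeal → ¬ 𝔪 ≤ w.asIdeal →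
      θ.IsUnramifiedAt w ∧ ∃ P : Polynomial (padicCoeffIntegers S),
        P.map (padicCoeffIntegers S).subtype = X - C (e.symm (ψ w)) ∧ θ.HasFrobCharpolyAt w P)
    {σ : absoluteGaloisGroup K}
    (hσ : ∀ n : ℕ, σ ∈ absGaloisFixingSubgroup (rayClassField K (𝔪 * Ideal.span {((p : ℕ) : 𝓞 K)} ^ (n + 1)))) :
    ((θ σ : GL (Fin 1) (padicCoeffIntegers S)) : Matrix (Fin 1) (Fin 1) (padicCoeffIntegers S)) 0 0 = 1 := by
  have hp1 : ‖(p : padicCoeffIntegers S)‖ < 1 := by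
    rw [norm_natCast_coeffIntegers]; exact Literature.NumberTheory.Automorphic.PadicAlgCl.norm_natCast_p_lt_one p
  have hle : ∀ n : ℕ, ‖((θ σ : GL (Fin 1) (padicCoeffIntegers S)) : Matrix (Fin 1) (Fin 1) (padicCoeffIntegers S)) 0 0 - 1‖ ≤
      ‖(p : padicCoeffIntegers S)‖ ^ (n + 1) := fun n ↦ by
    obtain ⟨h1, h2, h3⟩ := mul_span_natCast_pow_props (K := K) (p := p) h𝔪 n
    exact norm_apply_sub_one_le_of_mem_fixingSubgroup h𝔪 hψ e S θ hθ h1 h2 h3 (hσ n)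
  have h0 : ‖((θ σ : GL (Fin 1) (padicCoeffIntegers S)) : Matrix (Fin 1) (Fin 1) (padicCoeffIntegers S)) 0 0 - 1‖ ≤ 0 :=
    ge_of_tendsto' ((tendsto_pow_atTop_nhds_zero_of_lt_one (norm_nonneg _) hp1).comp (tendsto_add_atTop_nat 1)) hle
  rw [← sub_eq_zero, ← norm_le_zero_iff]
  exact h0

/-- ★★ The same for the dual character: **`θ'(σ) = 1` for `σ ∈ Gal(K̄/K(𝔪p^∞))`** (`θ'·θ₀₀ = 1`). [cite: deShalit1987, II.1.4–1.7 (p. 35–41)]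
[cite: SerreAbelianLadic1968, Ch. II §2.7] -/
theorem dual_eq_one_of_forall_mem_fixingSubgroup [IsTotallyComplex K] {𝔪 : Ideal (𝓞 K)} (h𝔪 : 𝔪 ≠ ⊥)
    {a b : InfinitePlace K → ℤ} {ψ : HeightOneSpectrum (𝓞 K) → ℂ} (hψ : IsGrossencharakter 𝔪 a b ψ)
    (e : PadicAlgCl p ≃+* ℂ) (S : Set (PadicAlgCl p)) (θ : FramedGaloisRep K (padicCoeffIntegers S) 1)
    (hθ : ∀ w : HeightOneSpectrum (𝓞 K), ((p : ℕ) : 𝓞 K) ∉ w.asIdeal → ¬ 𝔪 ≤ w.asIdeal →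
      θ.IsUnramifiedAt w ∧ ∃ P : Polynomial (padicCoeffIntegers S),
        P.map (padicCoeffIntegers S).subtype = X - C (e.symm (ψ w)) ∧ θ.HasFrobCharpolyAt w P)
    (θ' : absoluteGaloisGroup K →ₜ* (padicCoeffIntegers S)ˣ)
    (hθ' : ∀ g : absoluteGaloisGroup K, ((θ' g : (padicCoeffIntegers S)ˣ) : padicCoeffIntegers S) *
      ((θ g : GL (Fin 1) (padicCoeffIntegers S)) : Matrix (Fin 1) (Fin 1) (padicCoeffIntegers S)) 0 0 = 1)
    {σ : absoluteGaloisGroup K}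
    (hσ : ∀ n : ℕ, σ ∈ absGaloisFixingSubgroup (rayClassField K (𝔪 * Ideal.span {((p : ℕ) : 𝓞 K)} ^ (n + 1)))) :
    θ' σ = 1 := by
  have h := hθ' σ
  rw [apply_eq_one_of_forall_mem_fixingSubgroup h𝔪 hψ e S θ hθ hσ, mul_one] at h
  exact Units.ext h

end Summit.BirchSwinnertonDyer.BirchSwinnertonDyer.Theorems.SmallImageRttD2FrameReciprocity

end
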